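import Summits.QuantumFields.YangMills.Theorems.PoincareLipschitzCovariantOneFormMeanValue
import HarnessLib

/-!
# Line «poincare_lipschitz» on crux `HistoryTailL` (stmt-QuantumFields-19936), route crux `BlockLipschitzL` (stmt-QuantumFields-23533), K2 organ M-COUL,
# brick COV-GRAD-EXCESS part (a) «COV-GRAD-SUP» — THE COVARIANT INTERIOR GRADIENT BOUND FOR A COVARIANT-HARMONIC SECTION:
# `‖D_μh(x₀)‖² ≤ 4K·R^{−d}·Σ_{Q_R}‖D_μh‖² + C_d(R)·θ²·(sup‖h‖ + (2R+3)(d−1)·sup‖Dh‖)²` — FLAT constants, curvature enters ONLY through the holonomy `θ`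

Cell `ym3-torus` (YM ladder rung R3 = continuum SU(2) Yang–Mills on the three-torus — a RUNG, NOT the Clay problem: not d = 4, not infinite volume, not a
mass gap); width seat `ym-ust-19936-w2` g11 (F6 pen; LEAD ★w1-19936 g8 WORD 5's skeleton «COV-GRAD-EXCESS → w2»).  THEOREMS ONLY (def-free);
`--supports stmt-QuantumFields-19936`.  Nothing here proves M-COUL, the charts, h⋆, a stub, `BlockLipschitzL`, `HistoryTailL` or a summit statement.

WHY.  ★w5 g11's M-COUL-LOCATE (19936 evidence #51) §2: of the four steps of the flat `ℓ^∞`-Riesz bound ✓`PoincareLipschitzFlatRieszLogSup`, only (C2) — the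
gradient excess decay for a covariant-harmonic `h` — does not transfer for free, because `D_μh` is NOT covariant-harmonic: by ✓`covLop_oneForm_eq` the 1-form
`Y := Dh` has curl `= (holonomy − 1)·h` and divergence `= −Δ_τh = 0`.  The flat chain ✓`B4Eq19LatticeGradientExcessDecay` starts from the interior GRADIENT SUP
bound of a harmonic function (✓`sq_fdiff_le_of_harmonic`).  THIS FILE is its covariant twin, read off px7's ★★`normSq_le_of_cov_curl_div_hol` (✓p688088) at
`Y := Dh`: the curl slot is `θ·sup‖h‖` (exact cancellation of the eight first-order terms, `curl(Dh)(y;ν,μ) = (τ_ν(y)τ_μ(y+e_ν) − τ_μ(y)τ_ν(y+e_μ))·h(y+e_μ+e_ν)`),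
the divergence slot is `0` (the expanded `Δ_τh = 0` read at `y + e_μ`), the holonomy and sup slots pass through.  Part (b) (the excess decay proper, comb-gauge
reduction to the flat sourced Campanato step) is the sequel.

SETTING = px7's (V, τ) letters VERBATIM (✓p685881 header): `V` a real inner-product space, `τ : Fin d → ℤ^d → (V ≃ₗᵢ[ℝ] V)`, `D_μu(y) = τ μ y (u(y+e_μ)) − u(y)`,
covariant-harmonic = `Σ_μ ((h y + h y) − (τ μ (y−e_μ))⁻¹(h(y−e_μ)) − τ μ y (h(y+e_μ))) = 0`.

WHAT IS PROVED (ns `…Theorems.PoincareLipschitzCovariantGradientSup`).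
* §1 `curl_covD_eq` (the exact cancellation), `norm_curl_covD_le`, `div_covD_eq_zero_of_covHarmonic`.
* §2 ★★ `normSq_covD_le_of_covHarmonic` — the title, hypotheses: harmonic on `Q_{R+2}(x₀)`, plaquette commutator `‖τ_ν(y)τ_μ(y+e_ν)v − τ_μ(y)τ_ν(y+e_μ)v‖ ≤ θ‖v‖`
  and px7's `hHol` shape on `Q_{R+1}(x₀)`, `‖h‖ ≤ H` on `Q_{R+3}(x₀)`, `‖D_νh‖ ≤ S` off-direction on `Q_{R+2}`-translates; constants = ✓p688088's with `κ := θH`, `δ := 0`.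
HONEST SCOPE.  A corollary of ✓p688088; [folklore] ([Giaquinta1984] Ch. III §2; [Balaban1985BackgroundPropagators] (3.23)–(3.25)).  YM₃ on T³ is rung R3, not Clay.
-/

set_option autoImplicit false

noncomputable section

open scoped BigOperators
open Finset

namespace Summit.QuantumFields.YangMills.Theorems.PoincareLipschitzCovariantGradientSup

open Literature.MathematicalPhysics.QuantumFieldTheory.Balaban1983to89
open B4Eq19LatticeOperators
open Summit.QuantumFields.YangMills.Theorems.PoincareLipschitzCovariantOneFormMeanValue (normSq_le_of_cov_curl_div_hol)

variable {d : ℕ} {V : Type*} [NormedAddCommGroup V] [InnerProductSpace ℝ V]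

/-! ## §1 The 1-form `Dh`: curl = holonomy·h, divergence = −Δ_τ h -/

/-- **EXACT**: the covariant curl of `Y := Dh` at `(y; ν, μ)` is the plaquette commutator applied to `h(y+e_μ+e_ν)` — the eight first-order terms cancel in pairs.
[folklore] [cite: Balaban1985BackgroundPropagators, (3.4) p.391] -/
theorem curl_covD_eq (τ : Fin d → Zd d → (V ≃ₗᵢ[ℝ] V)) (h : Zd d → V) (y : Zd d) (ν μ : Fin d) :
    (τ ν y ((τ μ (y + unitVec ν) (h (y + unitVec ν + unitVec μ))) - h (y + unitVec ν)) - (τ μ y (h (y + unitVec μ)) - h y)) -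
      (τ μ y ((τ ν (y + unitVec μ) (h (y + unitVec μ + unitVec ν))) - h (y + unitVec μ)) - (τ ν y (h (y + unitVec ν)) - h y)) =
    τ ν y (τ μ (y + unitVec ν) (h (y + unitVec ν + unitVec μ))) - τ μ y (τ ν (y + unitVec μ) (h (y + unitVec μ + unitVec ν))) := by
  simp only [map_sub]
  abel

/-- `‖curl(Dh)(y;ν,μ)‖ ≤ θ·‖h(y+e_μ+e_ν)‖` under the plaquette-commutator bound. [folklore] [cite: Balaban1985BackgroundPropagators, (3.23) p.394] -/
theorem norm_curl_covD_le (τ : Fin d → Zd d → (V ≃ₗᵢ[ℝ] V)) (h : Zd d → V) (y : Zd d) (ν μ : Fin d) {θ : ℝ}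
    (hcomm : ∀ v : V, ‖τ ν y (τ μ (y + unitVec ν) v) - τ μ y (τ ν (y + unitVec μ) v)‖ ≤ θ * ‖v‖) :
    ‖(τ ν y ((τ μ (y + unitVec ν) (h (y + unitVec ν + unitVec μ))) - h (y + unitVec ν)) - (τ μ y (h (y + unitVec μ)) - h y)) -
      (τ μ y ((τ ν (y + unitVec μ) (h (y + unitVec μ + unitVec ν))) - h (y + unitVec μ)) - (τ ν y (h (y + unitVec ν)) - h y))‖ ≤
    θ * ‖h (y + unitVec ν + unitVec μ)‖ := by
  rw [curl_covD_eq, show y + unitVec μ + unitVec ν = y + unitVec ν + unitVec μ by abel]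
  exact hcomm _

/-- The covariant divergence of `Y := Dh`, read at `x`, IS the expanded `−Δ_τh(x)` (term by term); so it vanishes where `h` is covariant-harmonic. [folklore]
[cite: Balaban1985BackgroundPropagators, (3.8) p.392] -/
theorem div_covD_eq_zero_of_covHarmonic (τ : Fin d → Zd d → (V ≃ₗᵢ[ℝ] V)) (h : Zd d → V) (x : Zd d)
    (hh : ∑ ν, ((h x + h x) - (τ ν (x - unitVec ν)).symm (h (x - unitVec ν)) - τ ν x (h (x + unitVec ν))) = 0) :
    ∑ ν, ((τ ν (x - unitVec ν)).symm ((τ ν (x - unitVec ν) (h (x - unitVec ν + unitVec ν))) - h (x - unitVec ν)) -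
      (τ ν x (h (x + unitVec ν)) - h x)) = 0 := by
  have e : ∀ ν : Fin d, (τ ν (x - unitVec ν)).symm ((τ ν (x - unitVec ν) (h (x - unitVec ν + unitVec ν))) - h (x - unitVec ν)) -
      (τ ν x (h (x + unitVec ν)) - h x) =
      ((h x + h x) - (τ ν (x - unitVec ν)).symm (h (x - unitVec ν)) - τ ν x (h (x + unitVec ν))) := by
    intro ν
    rw [map_sub, LinearIsometryEquiv.symm_apply_apply, show x - unitVec ν + unitVec ν = x by abel]
    abel
  simp_rw [e]
  exact hh

/-! ## §2 The covariant interior gradient bound -/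

/-- ★★ **COV-GRAD-SUP.**  Let `h : ℤ^d → V` be covariant-harmonic on `Q_{R+2}(x₀)` (`R ≥ 4`), let the plaquette transports satisfy the commutator bound
`‖τ_ν(y)τ_μ(y+e_ν)v − τ_μ(y)τ_ν(y+e_μ)v‖ ≤ θ‖v‖` and px7's holonomy bound on `Q_{R+1}(x₀)`, let `‖h‖ ≤ H` on `Q_{R+3}(x₀)` and `‖D_νh(y−e_ν+e_μ)‖ ≤ S` for
`y ∈ Q_{R+1}(x₀)`, `ν ≠ μ`.  Then
`‖D_μh(x₀)‖² ≤ 4K·Σ_{y∈Q_R(x₀)}‖D_μh(y)‖² + (4K(2R+1)^d + 2)·(64·2^d·d·(θH + 0 + (2(R+1)+1)·(θ·((d−1)·S)))·(2R+1))²`, `K = 16(336·d·2^d)^d∕R^d` —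
✓`normSq_le_of_cov_curl_div_hol` at `Y := Dh` with `κ := θH` (§1) and `δ := 0` (§1). [folklore] [cite: Giaquinta1984, Ch. III §2 (2.5) p.78; Balaban1985BackgroundPropagators, (3.23)-(3.25) p.394] -/
theorem normSq_covD_le_of_covHarmonic [FiniteDimensional ℝ V] (hd : 1 ≤ d) (τ : Fin d → Zd d → (V ≃ₗᵢ[ℝ] V)) (h : Zd d → V)
    (x₀ : Zd d) {R : ℤ} (hR : 4 ≤ R) (μ : Fin d) {θ H S : ℝ} (hθ0 : 0 ≤ θ) (hH0 : 0 ≤ H) (hS0 : 0 ≤ S)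
    (hharm : ∀ x ∈ box x₀ (R + 2), ∑ ν, ((h x + h x) - (τ ν (x - unitVec ν)).symm (h (x - unitVec ν)) - τ ν x (h (x + unitVec ν))) = 0)
    (hcomm : ∀ y ∈ box x₀ (R + 1), ∀ ν : Fin d, ∀ v : V, ‖τ ν y (τ μ (y + unitVec ν) v) - τ μ y (τ ν (y + unitVec μ) v)‖ ≤ θ * ‖v‖)
    (hHol : ∀ y ∈ box x₀ (R + 1), ∀ ν : Fin d, ν ≠ μ → ∀ v : V,
      ‖τ μ (y - unitVec ν) (τ ν (y - unitVec ν + unitVec μ) ((τ μ y).symm ((τ ν (y - unitVec ν)).symm v))) - v‖ ≤ θ * ‖v‖)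
    (hH : ∀ y ∈ box x₀ (R + 3), ‖h y‖ ≤ H)
    (hS : ∀ y ∈ box x₀ (R + 1), ∀ ν : Fin d, ν ≠ μ → ‖τ ν (y - unitVec ν + unitVec μ) (h (y - unitVec ν + unitVec μ + unitVec ν)) - h (y - unitVec ν + unitVec μ)‖ ≤ S) :
    ‖τ μ x₀ (h (x₀ + unitVec μ)) - h x₀‖ ^ 2 ≤
      4 * (16 * (336 * (d : ℝ) * (2 : ℝ) ^ d) ^ d / (R : ℝ) ^ d) * ∑ y ∈ box x₀ R, ‖τ μ y (h (y + unitVec μ)) - h y‖ ^ 2 +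
      (4 * (16 * (336 * (d : ℝ) * (2 : ℝ) ^ d) ^ d / (R : ℝ) ^ d) * (2 * (R : ℝ) + 1) ^ d + 2) *
        (64 * (2 : ℝ) ^ d * d * (θ * H + 0 + (2 * ((R : ℝ) + 1) + 1) * (θ * (((d : ℝ) - 1) * S))) * (2 * (R : ℝ) + 1)) ^ 2 := by
  -- the 1-form `Y := Dh`
  have key := normSq_le_of_cov_curl_div_hol hd τ (fun y ν => τ ν y (h (y + unitVec ν)) - h y) x₀ hR μ
    (κ := θ * H) (δ := 0) (θ := θ) (S := S) (by positivity) le_rfl hθ0 hS0 ?_ ?_ hHol ?_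
  · exact key
  · -- curl: `θ·‖h(y+e_ν+e_μ)‖ ≤ θ·H` (`y + e_ν + e_μ ∈ Q_{R+3}(x₀)` for `y ∈ Q_{R+1}(x₀)`)
    intro y hy ν
    refine (norm_curl_covD_le τ h y ν μ (hcomm y hy ν)).trans (mul_le_mul_of_nonneg_left (hH _ ?_) hθ0)
    have := add_unitVec_mem_box (add_unitVec_mem_box hy ν) μ
    rwa [show R + 1 + 1 + 1 = R + 3 by ring] at this
  · -- divergence at `y + e_μ ∈ Q_{R+2}(x₀)`: zero
    intro y hy
    have hx : y + unitVec μ ∈ box x₀ (R + 2) := by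
      have := add_unitVec_mem_box hy μ
      rwa [show R + 1 + 1 = R + 2 by ring] at this
    have h0 := div_covD_eq_zero_of_covHarmonic τ h (y + unitVec μ) (hharm _ hx)
    have e : ∀ ν : Fin d, y + unitVec μ - unitVec ν + unitVec ν = y + unitVec μ := fun ν => by abel
    simp_rw [e] at h0 ⊢
    rw [h0, norm_zero]
  · -- the off-direction sup
    intro y hy ν hν
    exact hS y hy ν hν
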